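import Literature.AlgebraicGeometry.HodgeTheory.CyclicReflectionRestricted
import Literature.AlgebraicGeometry.HodgeTheory.UnitaryReflectionGroupZariskiDense
import Literature.AlgebraicGeometry.HodgeTheory.StabilizerRestrictionHom
import HarnessLib

/-!
# Normalising the eigencomponents: `h(δ̂_j, δ̂_j) = ε_j = ±1` and `r_ℂ|H(ζ^j) = s_{δ̂_j}` is Carlson–Toledo's
# complex `ζ^j`-reflection (1999, §7: "we can normalize the eigenvector … to `h(δ_i, δ_i) = ε_i = ±1`,
# … `T_δ` acts on `H^n_{ζ^i}` as `T^i_{δ_i}`") — packaging, part 8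

Family `hodge`, layer `Literature/AlgebraicGeometry/HodgeTheory`. DEFINITIONS (`hermitianSign`, `normalizeRoot`)
+ THEOREMS. Sequel of `CyclicReflectionRestricted` (the reflection formula on `H(ζ^j)`), linking it with the
tree's `complexReflection` (`UnitaryReflectionGroupZariskiDense`) and with the restriction apparatus
`restrictLinearEquiv` (`StabilizerRestrictionHom`), for crux K1 of
`Summits/HodgeConjecture/HodgeConjecture/Theses/CyclicUnitaryPowers.lean` (lane D glue, holes S3–S5 of the
skeleton: the generators of `ρ_j(Γ ⊗ ℂ)` ARE complex reflections of the hermitian space `(H(ζ^j), h)` along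
unit roots).
* `hermitianSign B x = h(x,x)/‖h(x,x)‖` (`= ±1` when `h(x,x) ≠ 0`), `normalizeRoot B x = ‖h(x,x)‖^{-1/2} x`,
  `h(x̂, x̂) = hermitianSign B x`;
* `baseChange_reflection_apply_eq_complexReflection` — for a cyclic reflection `r` of statement D and
  `x ∈ H(ζ^j)`: `r_ℂ x = complexReflection h ε_j (ζ^j) δ̂_j x`;
* `coe_complexReflection_domRestrict` and `restrictLinearEquiv_eq_complexReflection` — the same identity for
  the restriction to the subspace `H(ζ^j)` with the restricted form `h|H(ζ^j)`.
Written by the prover seat `hodge-nonav-prover-Ax`.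

## References
* [CarlsonToledo1999] J. A. Carlson, D. Toledo, *Discriminant complements and kernels of monodromy
  representations*, Duke Math. J. 97 (1999), §7 (p. 16), §6 Proposition 2 (p. 14).
-/

noncomputable section

open Module Literature.AlgebraicGeometry.Motives
open scoped TensorProduct ComplexConjugate

namespace Literature.AlgebraicGeometry.HodgeTheory

universe v

variable {V : Type v} [AddCommGroup V] [Module ℚ V]

/-! ### §1 Sign and normalisation of a non-isotropic vector -/

/-- The **sign** `ε = h(x,x)/‖h(x,x)‖` of a vector for the hermitian form `h = hermitianOfBilin B`
(`= ±1` when `h(x,x) ≠ 0`, Carlson–Toledo's `ε_i`). [cite: CarlsonToledo1999, §7 (p. 16)] -/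
def hermitianSign (B : LinearMap.BilinForm ℚ V) (x : ℂ ⊗[ℚ] V) : ℂ :=
  hermitianOfBilin B x x / (‖hermitianOfBilin B x x‖ : ℂ)

/-- The **normalised root** `x̂ = ‖h(x,x)‖^{-1/2} · x` (Carlson–Toledo's normalised eigenvector `δ_i`).
[cite: CarlsonToledo1999, §7 (p. 16)] -/
def normalizeRoot (B : LinearMap.BilinForm ℚ V) (x : ℂ ⊗[ℚ] V) : ℂ ⊗[ℚ] V :=
  (((Real.sqrt ‖hermitianOfBilin B x x‖)⁻¹ : ℝ) : ℂ) • x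

/-- [cite: CarlsonToledo1999, §7 (p. 16)] -/
theorem hermitianSign_def (B : LinearMap.BilinForm ℚ V) (x : ℂ ⊗[ℚ] V) :
    hermitianSign B x = hermitianOfBilin B x x / (‖hermitianOfBilin B x x‖ : ℂ) := rfl

/-- [cite: CarlsonToledo1999, §7 (p. 16)] -/
theorem normalizeRoot_def (B : LinearMap.BilinForm ℚ V) (x : ℂ ⊗[ℚ] V) :
    normalizeRoot B x = (((Real.sqrt ‖hermitianOfBilin B x x‖)⁻¹ : ℝ) : ℂ) • x := rfl

/-- `h(x, x)` is real for `B` symmetric (`h` hermitian). [cite: CarlsonToledo1999, §5 (p. 11)] -/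
theorem conj_hermitianOfBilin_self {B : LinearMap.BilinForm ℚ V} (hB : B.IsSymm) (x : ℂ ⊗[ℚ] V) :
    conj (hermitianOfBilin B x x) = hermitianOfBilin B x x :=
  (isSymm_hermitianOfBilin hB).eq x x

/-- `h(x,x) · h(x,x) = ‖h(x,x)‖²` (real value). [cite: CarlsonToledo1999, §5 (p. 11)] -/
theorem hermitianOfBilin_self_mul_self {B : LinearMap.BilinForm ℚ V} (hB : B.IsSymm) (x : ℂ ⊗[ℚ] V) :
    hermitianOfBilin B x x * hermitianOfBilin B x x = ((‖hermitianOfBilin B x x‖ : ℝ) : ℂ) ^ 2 := by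
  obtain ⟨r, hr⟩ := Complex.conj_eq_iff_real.1 (conj_hermitianOfBilin_self hB x)
  rw [hr, Complex.norm_real, Real.norm_eq_abs, ← Complex.ofReal_mul, ← Complex.ofReal_pow, ← sq, sq_abs]

/-- **`ε = ±1`** when `h(x,x) ≠ 0`. [cite: CarlsonToledo1999, §7 (p. 16)] -/
theorem hermitianSign_eq_one_or {B : LinearMap.BilinForm ℚ V} (hB : B.IsSymm) {x : ℂ ⊗[ℚ] V}
    (h0 : hermitianOfBilin B x x ≠ 0) : hermitianSign B x = 1 ∨ hermitianSign B x = -1 := by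
  obtain ⟨r, hr⟩ := Complex.conj_eq_iff_real.1 (conj_hermitianOfBilin_self hB x)
  rw [hermitianSign_def, hr, Complex.norm_real, Real.norm_eq_abs]
  have hr0 : r ≠ 0 := by rintro rfl; exact h0 (by rw [hr]; simp)
  rcases lt_or_gt_of_ne hr0 with hneg | hpos
  · right
    rw [abs_of_neg hneg, Complex.ofReal_neg, div_neg, div_self (by exact_mod_cast hr0)]
  · left
    rw [abs_of_pos hpos, div_self (by exact_mod_cast hr0)]

/-- `ε · ε = 1`. [cite: CarlsonToledo1999, §7 (p. 16)] -/
theorem hermitianSign_mul_self {B : LinearMap.BilinForm ℚ V} (hB : B.IsSymm) {x : ℂ ⊗[ℚ] V}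
    (h0 : hermitianOfBilin B x x ≠ 0) : hermitianSign B x * hermitianSign B x = 1 := by
  rcases hermitianSign_eq_one_or hB h0 with h | h <;> rw [h] <;> norm_num

/-- The normalisation identity `ε · (‖h(x,x)‖^{-1/2})² = h(x,x)⁻¹`. [cite: CarlsonToledo1999, §7 (p. 16)] -/
theorem hermitianSign_mul_inv_sqrt_mul_inv_sqrt {B : LinearMap.BilinForm ℚ V} (hB : B.IsSymm) {x : ℂ ⊗[ℚ] V}
    (h0 : hermitianOfBilin B x x ≠ 0) :
    hermitianSign B x * ((((Real.sqrt ‖hermitianOfBilin B x x‖)⁻¹ : ℝ) : ℂ) *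
      (((Real.sqrt ‖hermitianOfBilin B x x‖)⁻¹ : ℝ) : ℂ)) = (hermitianOfBilin B x x)⁻¹ := by
  have hn : 0 < ‖hermitianOfBilin B x x‖ := norm_pos_iff.2 h0
  have hsq : (((Real.sqrt ‖hermitianOfBilin B x x‖)⁻¹ : ℝ) : ℂ) * (((Real.sqrt ‖hermitianOfBilin B x x‖)⁻¹ : ℝ) : ℂ) =
      ((‖hermitianOfBilin B x x‖ : ℝ) : ℂ)⁻¹ := by
    rw [← Complex.ofReal_mul, ← mul_inv, Real.mul_self_sqrt hn.le, Complex.ofReal_inv]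
  obtain ⟨r, hr⟩ := Complex.conj_eq_iff_real.1 (conj_hermitianOfBilin_self hB x)
  have hr0 : (r : ℂ) ≠ 0 := by rw [← hr]; exact h0
  rw [hsq, hermitianSign_def, hr, Complex.norm_real, Real.norm_eq_abs, div_eq_mul_inv, mul_assoc, ← mul_inv,
    ← Complex.ofReal_mul, abs_mul_abs_self, Complex.ofReal_mul, mul_inv, ← mul_assoc, mul_inv_cancel₀ hr0, one_mul]

/-- **`h(x̂, x̂) = ε`**: the normalised root is a unit vector of sign `ε`. [cite: CarlsonToledo1999, §7 (p. 16)] -/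
theorem hermitianOfBilin_normalizeRoot_self {B : LinearMap.BilinForm ℚ V} (hB : B.IsSymm) {x : ℂ ⊗[ℚ] V}
    (h0 : hermitianOfBilin B x x ≠ 0) :
    hermitianOfBilin B (normalizeRoot B x) (normalizeRoot B x) = hermitianSign B x := by
  rw [normalizeRoot_def, LinearMap.map_smulₛₗ₂, map_smul, smul_eq_mul, smul_eq_mul, Complex.conj_ofReal,
    ← mul_assoc]
  have h := hermitianSign_mul_inv_sqrt_mul_inv_sqrt hB h0
  have hε := hermitianSign_mul_self hB h0
  -- `s² = ε · h(x,x)⁻¹` (multiply the normalisation identity by `ε`)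
  have hs : (((Real.sqrt ‖hermitianOfBilin B x x‖)⁻¹ : ℝ) : ℂ) * (((Real.sqrt ‖hermitianOfBilin B x x‖)⁻¹ : ℝ) : ℂ) =
      hermitianSign B x * (hermitianOfBilin B x x)⁻¹ := by
    have := congrArg (fun z => hermitianSign B x * z) h
    simp only [← mul_assoc, hε, one_mul] at this
    exact this
  rw [hs, mul_assoc, inv_mul_cancel₀ h0, mul_one]

/-- The normalised root lies in any subspace containing the root. [cite: CarlsonToledo1999, §7 (p. 16)] -/
theorem normalizeRoot_mem {B : LinearMap.BilinForm ℚ V} {E : Submodule ℂ (ℂ ⊗[ℚ] V)} {x : ℂ ⊗[ℚ] V}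
    (hx : x ∈ E) : normalizeRoot B x ∈ E :=
  E.smul_mem _ hx

/-! ### §2 The cyclic reflection on `H(ζ^j)` is the complex `ζ^j`-reflection along `δ̂_j` -/

/-- **`r_ℂ|H(ζ^j) = s_{δ̂_j}`**: for a cyclic reflection `r` of statement D (clauses `r = τ` on the cyclic span
of `δ`, `r = id` on its orthogonal) and `x ∈ H(ζ^j)`, `1 ≤ j < p`:
`r_ℂ x = complexReflection h ε_j (ζ^j) δ̂_j x = x + ε_j (ζ^j − 1) h(δ̂_j, x) δ̂_j`, with `δ̂_j` the normalised
eigencomponent and `ε_j = ±1` its sign ("`T_δ` acts on `H_{ζ^i}` as `T^i_{δ_i}`").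
[cite: CarlsonToledo1999, §7 (p. 16) and §6 Proposition 2 (p. 14)] -/
theorem baseChange_reflection_apply_eq_complexReflection [Module.Finite ℚ V] {τ r : V →ₗ[ℚ] V} {p : ℕ}
    (hp : p.Prime) (hτ : τ ^ p = 1) {ζ : ℂ} (hζ : IsPrimitiveRoot ζ p) {B : LinearMap.BilinForm ℚ V}
    (hB : B.IsSymm) (hτB : ∀ v w, B (τ v) (τ w) = B v w) {δ : V} (hδ : δ ≠ 0)
    (hsum : ∑ i ∈ Finset.range p, (τ ^ i) δ = 0)
    (hnd : ∀ x ∈ Submodule.span ℚ (Set.range fun i : ℕ => (τ ^ i) δ),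
      (∀ y ∈ Submodule.span ℚ (Set.range fun i : ℕ => (τ ^ i) δ), B x y = 0) → x = 0)
    (hr1 : ∀ x ∈ Submodule.span ℚ (Set.range fun i : ℕ => (τ ^ i) δ), r x = τ x)
    (hr2 : ∀ x, (∀ y ∈ Submodule.span ℚ (Set.range fun i : ℕ => (τ ^ i) δ), B x y = 0) → r x = x)
    {j : ℕ} (hj1 : 1 ≤ j) (hjp : j < p) {x : ℂ ⊗[ℚ] V}
    (hx : x ∈ Module.End.eigenspace (τ.baseChange ℂ) (ζ ^ j)) :
    r.baseChange ℂ x = complexReflection (hermitianOfBilin B) (hermitianSign B (eigencomponent τ p ζ j δ)) (ζ ^ j)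
      (normalizeRoot B (eigencomponent τ p ζ j δ)) x := by
  have hdd : hermitianOfBilin B (eigencomponent τ p ζ j δ) (eigencomponent τ p ζ j δ) ≠ 0 :=
    hermitianOfBilin_eigencomponent_self_ne_zero hp hτ hζ hB hτB hδ hsum hnd hj1 hjp
  rw [baseChange_reflection_apply_of_mem_eigenspace hp hτ hζ hB hτB hδ hsum hnd hr1 hr2 hj1 hjp hx,
    complexReflection_apply, normalizeRoot_def, LinearMap.map_smulₛₗ, LinearMap.smul_apply, smul_eq_mul,
    Complex.conj_ofReal, smul_smul]
  congr 1
  rw [div_eq_mul_inv, ← hermitianSign_mul_inv_sqrt_mul_inv_sqrt hB hdd]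
  ring

/-! ### §3 On the subspace `H(ζ^j)` with the restricted form -/

/-- The complex reflection of the restricted form `h|E` along a root in `E` is the restriction of the complex
reflection of `h`. [cite: CarlsonToledo1999, §7 (p. 16)] -/
theorem coe_complexReflection_domRestrict {W : Type*} [AddCommGroup W] [Module ℂ W]
    (h : W →ₗ⋆[ℂ] W →ₗ[ℂ] ℂ) (E : Submodule ℂ W) (ε l : ℂ) (δ x : E) :
    ((complexReflection (h.domRestrict₁₂ E E) ε l δ x : E) : W) = complexReflection h ε l (δ : W) x := by
  simp [complexReflection_apply, LinearMap.domRestrict₁₂_apply]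

/-- **The restriction of an automorphism acting on `E` as a complex reflection IS that complex reflection of
`(E, h|E)`**: if `γ ∈ Stab(E)` and `γ x = s_{δ}(x)` for `x ∈ E` (`δ ∈ E`), then
`restrictLinearEquiv E γ = complexReflection (h|E) ε l δ` as maps of `E`. [cite: CarlsonToledo1999, §7 (p. 16)] -/
theorem restrictLinearEquiv_eq_complexReflection {W : Type*} [AddCommGroup W] [Module ℂ W]
    (h : W →ₗ⋆[ℂ] W →ₗ[ℂ] ℂ) (E : Submodule ℂ W) {γ : W ≃ₗ[ℂ] W} (hγ : γ ∈ submoduleStabilizer E)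
    (ε l : ℂ) (δ : E) (hγE : ∀ x ∈ E, γ x = complexReflection h ε l (δ : W) x) :
    ((restrictLinearEquiv E γ hγ : E ≃ₗ[ℂ] E) : E →ₗ[ℂ] E) = complexReflection (h.domRestrict₁₂ E E) ε l δ := by
  refine LinearMap.ext fun x => Subtype.ext ?_
  rw [coe_complexReflection_domRestrict]
  exact hγE x x.2

/-- **The generator `ρ_j(r ⊗ ℂ)` is the complex `ζ^j`-reflection of `(H(ζ^j), h|H(ζ^j))` along `δ̂_j`** — the
form in which Carlson–Toledo's density theorem (`carlsonToledo1999_unitaryReflection_zariskiDense`) and the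
Goursat–Kolchin–Ribet bookkeeping consume the monodromy generators. [cite: CarlsonToledo1999, §7 (p. 16)] -/
theorem restrictLinearEquiv_baseChange_reflection_eq_complexReflection [Module.Finite ℚ V] {τ : V →ₗ[ℚ] V}
    {r : V ≃ₗ[ℚ] V} {p : ℕ} (hp : p.Prime) (hτ : τ ^ p = 1) {ζ : ℂ} (hζ : IsPrimitiveRoot ζ p)
    {B : LinearMap.BilinForm ℚ V} (hB : B.IsSymm) (hτB : ∀ v w, B (τ v) (τ w) = B v w) {δ : V} (hδ : δ ≠ 0)
    (hsum : ∑ i ∈ Finset.range p, (τ ^ i) δ = 0)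
    (hnd : ∀ x ∈ Submodule.span ℚ (Set.range fun i : ℕ => (τ ^ i) δ),
      (∀ y ∈ Submodule.span ℚ (Set.range fun i : ℕ => (τ ^ i) δ), B x y = 0) → x = 0)
    (hr1 : ∀ x ∈ Submodule.span ℚ (Set.range fun i : ℕ => (τ ^ i) δ), r x = τ x)
    (hr2 : ∀ x, (∀ y ∈ Submodule.span ℚ (Set.range fun i : ℕ => (τ ^ i) δ), B x y = 0) → r x = x)
    {j : ℕ} (hj1 : 1 ≤ j) (hjp : j < p)
    (hγ : glBaseChangeHom ℚ ℂ V r ∈ submoduleStabilizer (Module.End.eigenspace (τ.baseChange ℂ) (ζ ^ j))) :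
    ((restrictLinearEquiv _ (glBaseChangeHom ℚ ℂ V r) hγ :
        Module.End.eigenspace (τ.baseChange ℂ) (ζ ^ j) ≃ₗ[ℂ] Module.End.eigenspace (τ.baseChange ℂ) (ζ ^ j)) :
        Module.End.eigenspace (τ.baseChange ℂ) (ζ ^ j) →ₗ[ℂ] Module.End.eigenspace (τ.baseChange ℂ) (ζ ^ j)) =
      complexReflection ((hermitianOfBilin B).domRestrict₁₂ _ _) (hermitianSign B (eigencomponent τ p ζ j δ)) (ζ ^ j)
        ⟨normalizeRoot B (eigencomponent τ p ζ j δ),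
          normalizeRoot_mem (eigencomponent_mem_eigenspace hτ hζ.pow_eq_one (hζ.ne_zero hp.pos.ne') j δ)⟩ := by
  refine restrictLinearEquiv_eq_complexReflection _ _ hγ _ _ _ fun x hx => ?_
  change ((glBaseChangeHom ℚ ℂ V r : ℂ ⊗[ℚ] V ≃ₗ[ℂ] ℂ ⊗[ℚ] V) : ℂ ⊗[ℚ] V →ₗ[ℂ] ℂ ⊗[ℚ] V) x = _
  rw [coe_glBaseChangeHom]
  exact baseChange_reflection_apply_eq_complexReflection (r := (r : V →ₗ[ℚ] V)) hp hτ hζ hB hτB hδ hsum hnd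
    hr1 hr2 hj1 hjp hx

end Literature.AlgebraicGeometry.HodgeTheory

end
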